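import Mathlib
import HarnessLib
import Summits.NavierStokesRegularity.NavierStokesRegularity.Theorems.CompletionRelayChainRelayFrontStepIgnitionWakeFlux

/-!
# `CompletionRelayChain` — crux `RelayFrontStep` (24850), LINE `window_v2`, stub `stub_ignition` (Phase II):
  the NEAR-WAKE shell energies on `[0, T*]` (blueprint §2, first bootstrap)

Old shells `−3, −2, −1` start under the `W₃` shell-energy clauses `Σᵢ F₀ i k ≤ wakeS k = (1, ½, ¼)`. Along
the pseudo-flow each shell energy changes only through the bond fluxes (`shell_power_eq`); with the
Phase-I ENVELOPE facts on `[0, T*]` (carrier floor `x₀ ≥ −17/500`, `|u₀| ≤ 87/100`, `|u₋₁| ≤ 77/100`, from the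
certified tables of kit j302894) and the wake forcing `(W)` of old shell `−4`, a one-sided uniform bootstrap
(tree `bootstrap_family_oneSided_slack`, slack `51/50`) over the three shells gives, for `t ∈ [0, T*]`:
`Σᵢ F i (−3) t ≤ 1 + (57/2500)t`, `Σᵢ F i (−2) t ≤ ½ + (97/2500)t`, `Σᵢ F i (−1) t ≤ ¼ + (299/10000)t`
(`near_wake_phaseI`). The flux from `−2` into `−1` is bounded through the JOINT budget
`Σᵢ F i (−2) + Σᵢ F i (−1) ≤ ¾ + (201/10000)t ≤ 0.7962` (its power is `Φ₋₃ − Φ₋₁`, the internal flux cancels)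
and `Φ₋₂² ≤ W³/864` (`flux_abs_le` + `sq_mul_le_of_sum_le`).

No definitions. HONEST FRAMING: MODEL lattice only (Tao 2016 §4 vocabulary); helper for one registered stub of
an open crux, no stub credit; nothing here is a statement about the Navier–Stokes equations.
-/

noncomputable section

-- the summit-side namespace repeats a component by design (D-0017)
set_option linter.dupNamespace false

open Set MeasureTheory intervalIntegral Literature.Analysis.FluidPDE Literature.Analysis.FluidPDE.TaoCascade
open Summit.NavierStokesRegularity.NavierStokesRegularity.Theorems
open Summit.NavierStokesRegularity.NavierStokesRegularity.Theorems.RelayFrontStep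

namespace Summit.NavierStokesRegularity.NavierStokesRegularity.Cruxes.RelayFrontStep.Window2

variable {τ κ₁ κ₂ : ℝ} {α : Fin 4 → Fin 4 → Fin 4 → ℤ × ℤ × ℤ → ℝ}
  {S₀ F₀ B₀ : Fin 4 → ℤ → ℝ} {S F : Fin 4 → ℤ → ℝ → ℝ}

/-! ### Numerals -/

/-- `wakeS (−4) = 2`. [this file] -/
theorem wakeS_neg_four : wakeS (-4) = 2 := by
  unfold wakeS; norm_num

/-- `wakeS (−3) = 1`. [this file] -/
theorem wakeS_neg_three : wakeS (-3) = 1 := by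
  unfold wakeS; norm_num

/-- `wakeS (−2) = 1/2`. [this file] -/
theorem wakeS_neg_two : wakeS (-2) = 1 / 2 := by
  unfold wakeS; norm_num

/-- `wakeS (−1) = 1/4`. [this file] -/
theorem wakeS_neg_one : wakeS (-1) = 1 / 4 := by
  unfold wakeS
  rw [show (-(((-1 : ℤ)) : ℝ)) = (1 : ℕ) by norm_num, Real.rpow_natCast]
  norm_num

/-- `Λ₋₁ = 2^{−5/2} ≤ 0.177`. [this file] -/
theorem clock_neg_one_le : (1 + 1 : ℝ) ^ ((5 : ℝ) * (((-1 : ℤ)) : ℝ) / 2) ≤ 177 / 1000 := by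
  have h : (1 + 1 : ℝ) ^ ((5 : ℝ) * (((-1 : ℤ)) : ℝ) / 2) = (2 : ℝ) ^ (-(5 : ℝ) / 2) := by norm_num
  rw [h]; exact two_rpow_neg_five_halves_le

/-! ### Shell powers from fluxes -/

/-- **Shell power ≤ |inflow| + back-flow bound**: `Σᵢ quadTerm·S i k = Φ_{k−1} − Φ_k ≤ A + B` whenever
`|Φ_{k−1}| ≤ A` and `−Φ_k ≤ B`. [this file] -/
theorem power_le_of_fluxes (hrows : RelayRows α) (k : ℤ) (s : ℝ) {A B : ℝ}
    (hA : |(1 + 1 : ℝ) ^ ((5 : ℝ) * ((k - 1 : ℤ) : ℝ) / 2) * S 1 (k - 1) s *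
        (S 1 (k - 1) s * S 0 (k - 1 + 1) s + (1 / 32 : ℝ) * S 2 (k - 1) s * S 1 (k - 1 + 1) s)| ≤ A)
    (hB : -((1 + 1 : ℝ) ^ ((5 : ℝ) * (k : ℝ) / 2) * S 1 k s *
        (S 1 k s * S 0 (k + 1) s + (1 / 32 : ℝ) * S 2 k s * S 1 (k + 1) s)) ≤ B) :
    ∑ i, quadTerm 1 α S i k s * S i k s ≤ A + B := by
  rw [shell_power_eq hrows k s]
  simp only [sub_add_cancel, Int.cast_sub, Int.cast_one] at hA
  have h1 := le_abs_self ((1 + 1 : ℝ) ^ ((5 : ℝ) * ((k : ℝ) - 1) / 2) * S 1 (k - 1) s *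
        (S 1 (k - 1) s * S 0 k s + (1 / 32 : ℝ) * S 2 (k - 1) s * S 1 k s))
  linarith

/-- **Two-shell increment**: if the combined power of shells `k` and `k+1` is `≤ C` on `[s, t] ⊆ [0, τ]`, then
`(Σᵢ F i k + Σᵢ F i (k+1))(t) − (…)(s) ≤ C (t − s)`. [cite: Tao2016AveragedNS, §4 Lemma 4.1 (4.9)] -/
theorem pseudoFlowOn_two_shell_increment_le_const (h : PseudoFlowOn τ 1 α κ₁ κ₂ S₀ F₀ B₀ S F) (hτ : 0 < τ)
    (k : ℤ) {s t C : ℝ} (hs : 0 ≤ s) (hst : s ≤ t) (ht : t ≤ τ)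
    (hC : ∀ u ∈ Icc s t, ∑ i, quadTerm 1 α S i k u * S i k u +
        ∑ i, quadTerm 1 α S i (k + 1) u * S i (k + 1) u ≤ C) :
    (∑ i, F i k t + ∑ i, F i (k + 1) t) - (∑ i, F i k s + ∑ i, F i (k + 1) s) ≤ C * (t - s) := by
  have hsub : uIcc s t ⊆ Icc 0 τ := by rw [uIcc_of_le hst]; exact Icc_subset_Icc hs ht
  have hint : ∀ i (j : ℤ), IntervalIntegrable (fun u => quadTerm 1 α S i j u * S i j u) volume s t :=
    fun i j => ((pseudoFlowOn_continuousOn_quadTerm_mul h i j).mono hsub).intervalIntegrable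
  have h1 : ∀ i (j : ℤ), F i j t - F i j s ≤ ∫ u in s..t, quadTerm 1 α S i j u * S i j u := fun i j =>
    pseudoFlowOn_energy_increment_le h hτ i j hs hst ht
  have h2 : ∀ j : ℤ, ∑ i, (F i j t - F i j s) ≤ ∫ u in s..t, ∑ i, quadTerm 1 α S i j u * S i j u := by
    intro j
    rw [intervalIntegral.integral_finsetSum (fun i _ => hint i j)]
    exact Finset.sum_le_sum fun i _ => h1 i j
  have hint' : ∀ j : ℤ, IntervalIntegrable (fun u => ∑ i, quadTerm 1 α S i j u * S i j u) volume s t :=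
    fun j => (continuousOn_finsetSum _ fun i _ =>
      (pseudoFlowOn_continuousOn_quadTerm_mul h i j).mono hsub).intervalIntegrable
  have h3 : (∫ u in s..t, ((∑ i, quadTerm 1 α S i k u * S i k u) +
      ∑ i, quadTerm 1 α S i (k + 1) u * S i (k + 1) u)) ≤ ∫ u in s..t, C :=
    intervalIntegral.integral_mono_on hst ((hint' k).add (hint' (k + 1))) (by simp) fun u hu => hC u hu
  rw [intervalIntegral.integral_add (hint' k) (hint' (k + 1)), intervalIntegral.integral_const, smul_eq_mul]
    at h3
  have h2k := h2 k
  have h2k1 := h2 (k + 1)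
  rw [Finset.sum_sub_distrib] at h2k h2k1
  linarith

/-! ### Pointwise powers of the near-wake shells under caps -/

/-- Power of old shell `−3` under the caps: inflow from `−4` (energy `≤ 2.8` by `(W)`) and back-flow from
`−2`: `≤ 83/10000 + 29/2000 = 57/2500`. [this file] -/
theorem power_neg_three_le (h : PseudoFlowOn τ 1 α κ₁ κ₂ S₀ F₀ B₀ S F) (hrows : RelayRows α)
    {r : ℝ} (hr : r ∈ Icc 0 τ) (hr8 : r ≤ 8)
    (hW4 : ∑ i, F i (-4) r ≤ (1 + r / 20) * wakeS (-4))
    (h3 : ∑ i, F i (-3) r ≤ 561 / 500) (h2 : ∑ i, F i (-2) r ≤ 1683 / 2500) :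
    ∑ i, quadTerm 1 α S i (-3) r * S i (-3) r ≤ 57 / 2500 := by
  have e4 : ∑ i, F i (-3 - 1) r ≤ 14 / 5 := by
    rw [show (-3 - 1 : ℤ) = -4 by norm_num]
    rw [wakeS_neg_four] at hW4
    have : (1 + r / 20) * 2 ≤ 14 / 5 := by linarith
    linarith
  have e3 : ∑ i, F i (-3 - 1 + 1) r ≤ 561 / 500 := by
    rw [show (-3 - 1 + 1 : ℤ) = -3 by norm_num]; exact h3
  have e2 : ∑ i, F i (-3 + 1) r ≤ 1683 / 2500 := by
    rw [show (-3 + 1 : ℤ) = -2 by norm_num]; exact h2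
  have hA := flux_abs_le h hr e4 e3 (C := 83 / 10000) (by norm_num) (by norm_num)
  have hB := flux_abs_le h hr h3 e2 (C := 29 / 2000) (by norm_num) (by norm_num)
  have hB' := (neg_le_abs _).trans hB
  have := power_le_of_fluxes (S := S) hrows (-3) r hA hB'
  linarith

/-- Power of old shell `−2` under the caps and the joint budget `Σ F(−2) + Σ F(−1) ≤ W` with `W³/864 ≤ C²`:
`≤ 29/2000 + C`. [this file] -/
theorem power_neg_two_le (h : PseudoFlowOn τ 1 α κ₁ κ₂ S₀ F₀ B₀ S F) (hrows : RelayRows α)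
    {r : ℝ} (hr : r ∈ Icc 0 τ) {W C : ℝ} (hC : 0 ≤ C) (hWC : W ^ 3 / 864 ≤ C ^ 2)
    (h3 : ∑ i, F i (-3) r ≤ 561 / 500) (h2 : ∑ i, F i (-2) r ≤ 1683 / 2500)
    (hW : ∑ i, F i (-2) r + ∑ i, F i (-1) r ≤ W) :
    ∑ i, quadTerm 1 α S i (-2) r * S i (-2) r ≤ 29 / 2000 + C := by
  have e3 : ∑ i, F i (-2 - 1) r ≤ 561 / 500 := by
    rw [show (-2 - 1 : ℤ) = -3 by norm_num]; exact h3
  have e2 : ∑ i, F i (-2 - 1 + 1) r ≤ 1683 / 2500 := by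
    rw [show (-2 - 1 + 1 : ℤ) = -2 by norm_num]; exact h2
  have hA := flux_abs_le h hr e3 e2 (C := 29 / 2000) (by norm_num) (by norm_num)
  have hprod : (∑ i, F i (-2) r) ^ 2 * ∑ i, F i (-2 + 1) r ≤ 4 * W ^ 3 / 27 := by
    rw [show (-2 + 1 : ℤ) = -1 by norm_num]
    exact sq_mul_le_of_sum_le (Finset.sum_nonneg fun i _ => h.nonneg_F i _ r hr)
      (Finset.sum_nonneg fun i _ => h.nonneg_F i _ r hr) hW
  have hB := flux_abs_le h hr le_rfl le_rfl (C := C) hC (by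
    have : (8 : ℝ) * 2 ^ (5 * (-2 : ℤ)) = 1 / 128 := by norm_num
    rw [mul_assoc, this]; linarith)
  have hB' := (neg_le_abs _).trans hB
  have := power_le_of_fluxes (S := S) hrows (-2) r hA hB'
  linarith

/-- Power of old shell `−1` under the joint budget (inflow `≤ C`) and the back-flow bound from old shell `0`
(carrier floor `x₀ ≥ −Xm`, `|u₀| ≤ U0`, `u₋₁² ≤ U1sq`, `Σ F(−1) ≤ e`):
`≤ C + 0.177·(U1sq·Xm + e·U0/32)`. [this file] -/
theorem power_neg_one_le (h : PseudoFlowOn τ 1 α κ₁ κ₂ S₀ F₀ B₀ S F) (hrows : RelayRows α)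
    {r : ℝ} (hr : r ∈ Icc 0 τ) {W C Xm U0 U1sq e : ℝ} (hC : 0 ≤ C) (hWC : W ^ 3 / 864 ≤ C ^ 2)
    (hW : ∑ i, F i (-2) r + ∑ i, F i (-1) r ≤ W)
    (hXm : 0 ≤ Xm) (hx0 : -Xm ≤ S 0 0 r) (hu0 : |S 1 0 r| ≤ U0) (hum1 : S 1 (-1) r ^ 2 ≤ U1sq)
    (he : ∑ i, F i (-1) r ≤ e) (hpos : 0 ≤ U1sq * Xm + e * U0 / 32) :
    ∑ i, quadTerm 1 α S i (-1) r * S i (-1) r ≤ C + 177 / 1000 * (U1sq * Xm + e * U0 / 32) := by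
  have hprod : (∑ i, F i (-1 - 1) r) ^ 2 * ∑ i, F i (-1 - 1 + 1) r ≤ 4 * W ^ 3 / 27 := by
    rw [show (-1 - 1 + 1 : ℤ) = -1 by norm_num, show (-1 - 1 : ℤ) = -2 by norm_num]
    exact sq_mul_le_of_sum_le (Finset.sum_nonneg fun i _ => h.nonneg_F i _ r hr)
      (Finset.sum_nonneg fun i _ => h.nonneg_F i _ r hr) hW
  have hA := flux_abs_le h hr le_rfl le_rfl (C := C) hC (by
    have : (8 : ℝ) * 2 ^ (5 * (-1 - 1 : ℤ)) = 1 / 128 := by norm_num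
    rw [mul_assoc, this]; linarith)
  have hx0' : -Xm ≤ S 0 (-1 + 1) r := by rw [show (-1 + 1 : ℤ) = 0 by norm_num]; exact hx0
  have hu0' : |S 1 (-1 + 1) r| ≤ U0 := by rw [show (-1 + 1 : ℤ) = 0 by norm_num]; exact hu0
  have hB := neg_flux_le h hr hXm hx0' hu0' hum1 he
  have hB' : -((1 + 1 : ℝ) ^ ((5 : ℝ) * (((-1 : ℤ)) : ℝ) / 2) * S 1 (-1) r *
      (S 1 (-1) r * S 0 (-1 + 1) r + (1 / 32 : ℝ) * S 2 (-1) r * S 1 (-1 + 1) r)) ≤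
      177 / 1000 * (U1sq * Xm + e * U0 / 32) :=
    hB.trans (mul_le_mul_of_nonneg_right clock_neg_one_le hpos)
  have := power_le_of_fluxes (S := S) hrows (-1) r hA hB'
  linarith

/-- Combined power of old shells `−2, −1` (the internal flux cancels): `Φ₋₃ − Φ₋₁ ≤ 29/2000 + back-flow`.
[this file] -/
theorem power_pair_le (h : PseudoFlowOn τ 1 α κ₁ κ₂ S₀ F₀ B₀ S F) (hrows : RelayRows α)
    {r : ℝ} (hr : r ∈ Icc 0 τ) {Xm U0 U1sq e : ℝ}
    (h3 : ∑ i, F i (-3) r ≤ 561 / 500) (h2 : ∑ i, F i (-2) r ≤ 1683 / 2500)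
    (hXm : 0 ≤ Xm) (hx0 : -Xm ≤ S 0 0 r) (hu0 : |S 1 0 r| ≤ U0) (hum1 : S 1 (-1) r ^ 2 ≤ U1sq)
    (he : ∑ i, F i (-1) r ≤ e) (hpos : 0 ≤ U1sq * Xm + e * U0 / 32) :
    ∑ i, quadTerm 1 α S i (-2) r * S i (-2) r + ∑ i, quadTerm 1 α S i (-2 + 1) r * S i (-2 + 1) r ≤
      29 / 2000 + 177 / 1000 * (U1sq * Xm + e * U0 / 32) := by
  rw [show (-2 + 1 : ℤ) = -1 by norm_num, shell_power_eq hrows (-2) r, shell_power_eq hrows (-1) r]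
  have e3 : ∑ i, F i (-2 - 1) r ≤ 561 / 500 := by
    rw [show (-2 - 1 : ℤ) = -3 by norm_num]; exact h3
  have e2 : ∑ i, F i (-2 - 1 + 1) r ≤ 1683 / 2500 := by
    rw [show (-2 - 1 + 1 : ℤ) = -2 by norm_num]; exact h2
  have hA := flux_abs_le h hr e3 e2 (C := 29 / 2000) (by norm_num) (by norm_num)
  have hA' := (le_abs_self _).trans hA
  have hx0' : -Xm ≤ S 0 (-1 + 1) r := by rw [show (-1 + 1 : ℤ) = 0 by norm_num]; exact hx0
  have hu0' : |S 1 (-1 + 1) r| ≤ U0 := by rw [show (-1 + 1 : ℤ) = 0 by norm_num]; exact hu0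
  have hB := neg_flux_le h hr hXm hx0' hu0' hum1 he
  have hB' := hB.trans (mul_le_mul_of_nonneg_right clock_neg_one_le hpos)
  norm_num at hA' hB' ⊢
  linarith


/-! ### Phase I: rates under the weak caps, and the bootstrap on `[0, T*]` -/

/-- `T* ≤ 8`. [this file] -/
theorem Tstar_le_eight : Tstar ≤ 8 := by unfold Tstar; norm_num

/-- `0 ≤ T*`. [this file] -/
theorem Tstar_nonneg : 0 ≤ Tstar := by unfold Tstar; norm_num

/-- **PHASE-I RATES.** Under the weak caps `Σ F(−3) ≤ 1.122`, `Σ F(−2) ≤ 0.6732`, `Σ F(−1) ≤ 0.408` on `[0, t]`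
(`t ≤ T*`), the Phase-I envelope facts (`x₀ ≥ −17/500`, `|u₀| ≤ 87/100`, `|u₋₁| ≤ 77/100`) and the wake forcing
`(W)`: the joint budget `Σ F(−2) + Σ F(−1) ≤ ¾ + (201/10000)t` and the linear bounds
`Σ F(−3)(t) ≤ 1 + (57/2500)t`, `Σ F(−2)(t) ≤ ½ + (97/2500)t`, `Σ F(−1)(t) ≤ ¼ + (299/10000)t`.
[cite: Tao2016AveragedNS, §4 Lemma 4.1 (4.9), (4.10)] -/
theorem near_wake_rates_I (h : PseudoFlowOn τ 1 α κ₁ κ₂ S₀ F₀ B₀ S F) (hτ : 0 < τ) (hrows : RelayRows α)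
    {t : ℝ} (ht : t ∈ Icc 0 τ) (htT : t ≤ Tstar)
    (hwake : ∀ k : ℤ, k ≤ -1 → ∑ i, F₀ i k ≤ wakeS k)
    (hW4 : ∀ s ∈ Icc (0 : ℝ) τ, s ≤ 8 → ∑ i, F i (-4) s ≤ (1 + s / 20) * wakeS (-4))
    (hx0 : ∀ s ∈ Icc (0 : ℝ) t, -(17 / 500 : ℝ) ≤ S 0 0 s) (hu0 : ∀ s ∈ Icc (0 : ℝ) t, |S 1 0 s| ≤ 87 / 100)
    (hum1 : ∀ s ∈ Icc (0 : ℝ) t, |S 1 (-1) s| ≤ 77 / 100)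
    (h3 : ∀ s ∈ Icc (0 : ℝ) t, ∑ i, F i (-3) s ≤ 561 / 500)
    (h2 : ∀ s ∈ Icc (0 : ℝ) t, ∑ i, F i (-2) s ≤ 1683 / 2500)
    (h1 : ∀ s ∈ Icc (0 : ℝ) t, ∑ i, F i (-1) s ≤ 51 / 125) :
    ∑ i, F i (-2) t + ∑ i, F i (-1) t ≤ 3 / 4 + 201 / 10000 * t ∧
      ∑ i, F i (-3) t ≤ 1 + 57 / 2500 * t ∧ ∑ i, F i (-2) t ≤ 1 / 2 + 97 / 2500 * t ∧
        ∑ i, F i (-1) t ≤ 1 / 4 + 299 / 10000 * t := by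
  have hT8 := Tstar_le_eight
  have hsτ : ∀ s ∈ Icc (0 : ℝ) t, s ∈ Icc 0 τ := fun s hs => ⟨hs.1, hs.2.trans ht.2⟩
  -- start values
  have hF0 : ∀ k : ℤ, ∑ i, F i k 0 = ∑ i, F₀ i k := fun k => Finset.sum_congr rfl fun i _ => h.init_F i k
  have h30 : ∑ i, F i (-3) 0 ≤ 1 := by rw [hF0, ← wakeS_neg_three]; exact hwake (-3) (by norm_num)
  have h20 : ∑ i, F i (-2) 0 ≤ 1 / 2 := by rw [hF0, ← wakeS_neg_two]; exact hwake (-2) (by norm_num)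
  have h10 : ∑ i, F i (-1) 0 ≤ 1 / 4 := by rw [hF0, ← wakeS_neg_one]; exact hwake (-1) (by norm_num)
  -- pointwise ingredients on [0, t]
  have hsq : ∀ s ∈ Icc (0 : ℝ) t, S 1 (-1) s ^ 2 ≤ (77 / 100) ^ 2 := fun s hs => by
    rw [← sq_abs]; exact pow_le_pow_left₀ (abs_nonneg _) (hum1 s hs) 2
  have hBF : (177 / 1000 : ℝ) * ((77 / 100) ^ 2 * (17 / 500) + 51 / 125 * (87 / 100) / 32) ≤ 56 / 10000 := by
    norm_num
  have hpos : (0 : ℝ) ≤ (77 / 100) ^ 2 * (17 / 500) + 51 / 125 * (87 / 100) / 32 := by norm_num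
  -- the joint budget W(s) ≤ 3/4 + 0.0201 s on [0, t]
  have hWlin : ∀ s ∈ Icc (0 : ℝ) t, ∑ i, F i (-2) s + ∑ i, F i (-1) s ≤ 3 / 4 + 201 / 10000 * s := by
    intro s hs
    have hinc := pseudoFlowOn_two_shell_increment_le_const h hτ (-2) le_rfl hs.1 (hsτ s hs).2
      (C := 29 / 2000 + 177 / 1000 * ((77 / 100) ^ 2 * (17 / 500) + 51 / 125 * (87 / 100) / 32))
      (fun r hr => by
        have hr' : r ∈ Icc (0 : ℝ) t := ⟨hr.1, hr.2.trans hs.2⟩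
        exact power_pair_le h hrows (hsτ r hr') (h3 r hr') (h2 r hr') (by norm_num) (hx0 r hr') (hu0 r hr')
          (hsq r hr') (h1 r hr') hpos)
    rw [show (-2 + 1 : ℤ) = -1 by norm_num] at hinc
    have hs0 : 0 ≤ s := hs.1
    nlinarith
  have hWI : ∀ s ∈ Icc (0 : ℝ) t, ∑ i, F i (-2) s + ∑ i, F i (-1) s ≤ 7962 / 10000 := by
    intro s hs
    have := hWlin s hs
    have hsT : s ≤ 147 / 64 := hs.2.trans (htT.trans (by unfold Tstar; norm_num))
    linarith
  have hWC : ((7962 / 10000 : ℝ)) ^ 3 / 864 ≤ (243 / 10000) ^ 2 := by norm_num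
  -- pointwise powers
  have hP3 : ∀ r ∈ Icc (0 : ℝ) t, ∑ i, quadTerm 1 α S i (-3) r * S i (-3) r ≤ 57 / 2500 := fun r hr =>
    power_neg_three_le h hrows (hsτ r hr) (hr.2.trans (htT.trans hT8))
      (hW4 r (hsτ r hr) (hr.2.trans (htT.trans hT8))) (h3 r hr) (h2 r hr)
  have hP2 : ∀ r ∈ Icc (0 : ℝ) t, ∑ i, quadTerm 1 α S i (-2) r * S i (-2) r ≤ 29 / 2000 + 243 / 10000 :=
    fun r hr => power_neg_two_le h hrows (hsτ r hr) (by norm_num) hWC (h3 r hr) (h2 r hr) (hWI r hr)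
  have hP1 : ∀ r ∈ Icc (0 : ℝ) t, ∑ i, quadTerm 1 α S i (-1) r * S i (-1) r ≤
      243 / 10000 + 177 / 1000 * ((77 / 100) ^ 2 * (17 / 500) + 51 / 125 * (87 / 100) / 32) :=
    fun r hr => power_neg_one_le h hrows (hsτ r hr) (by norm_num) hWC (hWI r hr) (by norm_num) (hx0 r hr)
      (hu0 r hr) (hsq r hr) (h1 r hr) hpos
  have hI3 := pseudoFlowOn_shell_increment_le_const h hτ (-3) le_rfl ht.1 ht.2 hP3
  have hI2 := pseudoFlowOn_shell_increment_le_const h hτ (-2) le_rfl ht.1 ht.2 hP2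
  have hI1 := pseudoFlowOn_shell_increment_le_const h hτ (-1) le_rfl ht.1 ht.2 hP1
  have ht0 : 0 ≤ t := ht.1
  refine ⟨hWlin t ⟨ht.1, le_rfl⟩, ?_, ?_, ?_⟩
  · linarith
  · linarith
  · nlinarith

/-- **THE NEAR WAKE ON `[0, T*]`** (first bootstrap): along any `(η,η)`-pseudo-flow of a table with the relay
rows, started under the `W₃` wake clauses, with the wake forcing `(W)` and the Phase-I envelope facts on
`[0, T*]`, the near-wake shell energies obey `Σ F(−3)(t) ≤ 1 + (57/2500)t`, `Σ F(−2)(t) ≤ ½ + (97/2500)t`,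
`Σ F(−1)(t) ≤ ¼ + (299/10000)t` and `Σ F(−2) + Σ F(−1) ≤ ¾ + (201/10000)t` for `t ∈ [0, T*]`.
MODEL lattice; nothing about the Navier–Stokes equations. [cite: Tao2016AveragedNS, §4 Lemma 4.1 (4.9), (4.10)] -/
theorem near_wake_phaseI (h : PseudoFlowOn τ 1 α κ₁ κ₂ S₀ F₀ B₀ S F) (hτ : 0 < τ) (hrows : RelayRows α)
    (hTτ : Tstar ≤ τ)
    (hwake : ∀ k : ℤ, k ≤ -1 → ∑ i, F₀ i k ≤ wakeS k)
    (hW4 : ∀ s ∈ Icc (0 : ℝ) τ, s ≤ 8 → ∑ i, F i (-4) s ≤ (1 + s / 20) * wakeS (-4))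
    (hx0 : ∀ s ∈ Icc (0 : ℝ) Tstar, -(17 / 500 : ℝ) ≤ S 0 0 s)
    (hu0 : ∀ s ∈ Icc (0 : ℝ) Tstar, |S 1 0 s| ≤ 87 / 100)
    (hum1 : ∀ s ∈ Icc (0 : ℝ) Tstar, |S 1 (-1) s| ≤ 77 / 100) :
    ∀ t ∈ Icc (0 : ℝ) Tstar,
      ∑ i, F i (-2) t + ∑ i, F i (-1) t ≤ 3 / 4 + 201 / 10000 * t ∧
        ∑ i, F i (-3) t ≤ 1 + 57 / 2500 * t ∧ ∑ i, F i (-2) t ≤ 1 / 2 + 97 / 2500 * t ∧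
          ∑ i, F i (-1) t ≤ 1 / 4 + 299 / 10000 * t := by
  obtain ⟨M, hM0, hM⟩ := wake_apriori_abs h
  have hTI : ∀ t ∈ Icc (0 : ℝ) Tstar, t ∈ Icc 0 τ := fun t ht => ⟨ht.1, ht.2.trans hTτ⟩
  have hF0 : ∀ k : ℤ, ∑ i, F i k 0 = ∑ i, F₀ i k := fun k => Finset.sum_congr rfl fun i _ => h.init_F i k
  -- the three-member family j ↦ old shell (j − 3)
  let sh : Fin 3 → ℤ := ![-3, -2, -1]
  let p : Fin 3 → ℝ := ![11 / 10, 33 / 50, 2 / 5]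
  have hp : ∀ j, 0 ≤ p j := fun j => by fin_cases j <;> simp [p] <;> norm_num
  have hpmin : ∀ j, 2 / 5 ≤ p j := fun j => by fin_cases j <;> simp [p] <;> norm_num
  have hsh0 : ∀ j, sh j ≤ 0 := fun j => by fin_cases j <;> simp [sh]
  have key := bootstrap_family_oneSided_slack (u := fun j : Fin 3 => fun t => ∑ i, F i (sh j) t)
    (p := p) (ψ := fun _ => (1 : ℝ)) (τ := Tstar) (L := 15 / 2 * M ^ 3) (θ := 51 / 50) (by norm_num)
    hp (by positivity) continuousOn_const (fun _ _ => one_pos)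
    (fun j s hs t ht hst => by
      have hM3 : 0 ≤ 3 * M ^ 3 := by positivity
      have hL : 3 * M ^ 3 ≤ 15 / 2 * M ^ 3 * p j := by nlinarith [hpmin j]
      refine (pseudoFlowOn_shell_increment_le_const h hτ (sh j) hs.1 hst (hTI t ht).2 fun r hr => ?_).trans
        (mul_le_mul_of_nonneg_right hL (by linarith))
      have hrτ : r ∈ Icc 0 τ := ⟨hs.1.trans hr.1, hr.2.trans (hTI t ht).2⟩
      exact wake_shell_crude_rate hrows hM (hsh0 j) hrτ)
    (fun j => by
      fin_cases j
      · simp only [sh, p]; simp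
        try rw [hF0]
        exact (hwake (-3) (by norm_num)).trans (by rw [wakeS_neg_three]; norm_num)
      · simp only [sh, p]; simp
        try rw [hF0]
        exact (hwake (-2) (by norm_num)).trans (by rw [wakeS_neg_two]; norm_num)
      · simp only [sh, p]; simp
        try rw [hF0]
        exact (hwake (-1) (by norm_num)).trans (by rw [wakeS_neg_one]; norm_num))
    (fun t ht hweak => by
      have h3 : ∀ s ∈ Icc (0 : ℝ) t, ∑ i, F i (-3) s ≤ 561 / 500 := fun s hs => by
        have := hweak 0 s hs; simp only [sh, p] at this; simp at this; linarith
      have h2 : ∀ s ∈ Icc (0 : ℝ) t, ∑ i, F i (-2) s ≤ 1683 / 2500 := fun s hs => by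
        have := hweak 1 s hs; simp only [sh, p] at this; simp at this; linarith
      have h1 : ∀ s ∈ Icc (0 : ℝ) t, ∑ i, F i (-1) s ≤ 51 / 125 := fun s hs => by
        have := hweak 2 s hs; simp only [sh, p] at this; simp at this; linarith
      have hR := near_wake_rates_I h hτ hrows (hTI t ht) ht.2 hwake hW4
        (fun s hs => hx0 s ⟨hs.1, hs.2.trans ht.2⟩) (fun s hs => hu0 s ⟨hs.1, hs.2.trans ht.2⟩)
        (fun s hs => hum1 s ⟨hs.1, hs.2.trans ht.2⟩) h3 h2 h1
      have htT : t ≤ 147 / 64 := ht.2.trans (by unfold Tstar; norm_num)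
      intro j
      fin_cases j
      · simp only [sh, p]; simp; linarith [hR.2.1]
      · simp only [sh, p]; simp; linarith [hR.2.2.1]
      · simp only [sh, p]; simp; linarith [hR.2.2.2])
  intro t ht
  have h3 : ∀ s ∈ Icc (0 : ℝ) t, ∑ i, F i (-3) s ≤ 561 / 500 := fun s hs => by
    have := key 0 s ⟨hs.1, hs.2.trans ht.2⟩; simp only [sh, p] at this; simp at this; linarith
  have h2 : ∀ s ∈ Icc (0 : ℝ) t, ∑ i, F i (-2) s ≤ 1683 / 2500 := fun s hs => by
    have := key 1 s ⟨hs.1, hs.2.trans ht.2⟩; simp only [sh, p] at this; simp at this; linarith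
  have h1 : ∀ s ∈ Icc (0 : ℝ) t, ∑ i, F i (-1) s ≤ 51 / 125 := fun s hs => by
    have := key 2 s ⟨hs.1, hs.2.trans ht.2⟩; simp only [sh, p] at this; simp at this; linarith
  exact near_wake_rates_I h hτ hrows (hTI t ht) ht.2 hwake hW4
    (fun s hs => hx0 s ⟨hs.1, hs.2.trans ht.2⟩) (fun s hs => hu0 s ⟨hs.1, hs.2.trans ht.2⟩)
    (fun s hs => hum1 s ⟨hs.1, hs.2.trans ht.2⟩) h3 h2 h1

end Summit.NavierStokesRegularity.NavierStokesRegularity.Cruxes.RelayFrontStep.Window2
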